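import Summits.Schanuel.Schanuel.Theorems.DiophantineDichotomyApproximationPropertyCurveHilbertBezout
import Mathlib.Analysis.Complex.Polynomial.Basic
import Mathlib.FieldTheory.IsAlgClosed.Basic
import Mathlib.Algebra.Polynomial.FieldDivision
import Mathlib.Algebra.MvPolynomial.Variables
import HarnessLib

/-!
# Hilbert function of a space curve on a complete intersection, IV: a generic hyperplane section of a prime curve (crux `ApproximationProperty`, stub `curveHilbert_genericSection`)

Crux `stmt-Schanuel-6117` (`Summit.Schanuel.Schanuel.Theses.DiophantineDichotomy.ApproximationProperty`),
line `orbit-interpolation-determinant`; this file proves the registered stub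
`curveHilbert_genericSection` (sequel of `…CurveHilbertSection/Telescope/Bezout.lean`). Everything
here is PROVED; no definitions, no named facts.

Let `𝔭 ⊂ ℚ[x₀, …, x_m]` be a homogeneous prime with `dim ℚ[x̲]/𝔭 = 2` (a projective curve) and
`D = ideg 𝔭 2` the degree of its associated form `F`. **There is a rational polynomial `g ≠ 0` such
that every rational hyperplane `v · x = 0` with `g(v) ≠ 0` contains `D` pairwise non-proportional
points of `V(𝔭) ⊂ ℂ^{m+1}`.** Proof: on a chart `x_c ∉ 𝔭` let `F_v(x̲) = F(v; x̲) ∈ ℂ[x̲]` be the section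
form (homogeneous of degree `D`; `F_v(u) = 0` iff some `β ∈ V(𝔭)` lies on the hyperplanes `v` and
`u`, zeros theorem `aeval_chowForm_eq_zero_iff`). For generic `v` one has the specialised Bézout
identity `α F_v + β ∂F_v/∂x_c = γ`, `γ ≠ 0` free of `x_c` (`…CurveHilbertBezout.lean`), and
`F_v(e_c) ≠ 0` (`aLead_chowForm_ne_zero`). On the line `t ↦ p + (t − p_c) e_c`, `γ(p) ≠ 0`, the
polynomial `f(t) = F_v(…)` has degree `D` (top coefficient `F_v(e_c)`) and simple roots (a double
root `t₀` would give `γ(p) = γ(p + (t₀ − p_c) e_c) = 0`), hence `D` distinct roots `tᵢ` and zeros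
`βᵢ ∈ V(𝔭) ∩ v^⊥` with `βᵢ ⊥ uᵢ = p + (tᵢ − p_c) e_c`; `βᵢ ∝ β_k` would force `βᵢ ⊥ (tᵢ − t_k) e_c`, i.e.
`βᵢ ⊥ e_c` and `F_v(e_c) = 0`.

Sources: Nesterenko–Philippon (eds.), LNM 1752, Ch. 3 Prop. 4.4 and the remark after it (p. 38);
Hodge–Pedoe II, Ch. X §§6–8 (Cayley form of a generic linear section); folklore (Bézout).
-/

set_option linter.dupNamespace false

noncomputable section

namespace Summit.Schanuel.Schanuel.Cruxes.ApproximationProperty.OrbitInterpolationDeterminant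

open Literature.NumberTheory.Transcendental.Nesterenko MvPolynomial
open scoped Polynomial

namespace CurveHilbertGS

variable {m : ℕ}

/-! ## Restricting a complex form to a coordinate line -/

/-- A polynomial not involving `x_c` takes the same value at `p` and at `p` with its `c`-th
coordinate changed. [folklore] -/
theorem eval_update_eq_of_degreeOf {γ : MvPolynomial (Fin (m + 1)) ℂ} {c : Fin (m + 1)}
    (h : degreeOf c γ = 0) (p : Fin (m + 1) → ℂ) (t : ℂ) :
    eval (Function.update p c t) γ = eval p γ := by
  change eval₂Hom (RingHom.id ℂ) _ γ = eval₂Hom (RingHom.id ℂ) _ γ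
  refine eval₂Hom_congr' rfl (fun i hi _ => Function.update_of_ne ?_ _ _) rfl
  rintro rfl
  exact (mem_vars_iff_degreeOf_ne_zero.mp hi) h

/-- The restriction `f(t) = P(p + (t − p_c) e_c)` of `P` to the coordinate line through `p` in the
direction `e_c`, as a polynomial in `t`: its values. [folklore] -/
theorem eval_lineRestrict (P : MvPolynomial (Fin (m + 1)) ℂ) (p : Fin (m + 1) → ℂ)
    (c : Fin (m + 1)) (t : ℂ) :
    Polynomial.eval t (aeval (fun k => if k = c then Polynomial.X else Polynomial.C (p k)) P) =
      eval (Function.update p c t) P := by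
  rw [← Polynomial.coe_evalRingHom, map_aeval]
  have hf : (Polynomial.evalRingHom t).comp (algebraMap ℂ ℂ[X]) = RingHom.id ℂ :=
    RingHom.ext fun x => by simp
  have hg : (fun k => Polynomial.evalRingHom t (if k = c then Polynomial.X else Polynomial.C (p k)))
      = Function.update p c t := by
    funext k
    by_cases hk : k = c
    · subst hk; simp
    · simp [hk]
  rw [hf, hg]
  rfl

/-- The chain rule along the line: `f' = (∂P/∂x_c)` restricted. [folklore] -/
theorem derivative_lineRestrict (P : MvPolynomial (Fin (m + 1)) ℂ) (p : Fin (m + 1) → ℂ)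
    (c : Fin (m + 1)) :
    Polynomial.derivative (aeval (fun k => if k = c then Polynomial.X else Polynomial.C (p k)) P) =
      aeval (fun k => if k = c then Polynomial.X else Polynomial.C (p k)) (pderiv c P) := by
  induction P using MvPolynomial.induction_on with
  | C a =>
    rw [algHom_C, Polynomial.algebraMap_eq, pderiv_C, map_zero, Polynomial.derivative_C]
  | add p q hp hq =>
    rw [map_add, Polynomial.derivative_add, hp, hq, map_add, map_add]
  | mul_X q k hq =>
    classical
    rw [map_mul, aeval_X, Polynomial.derivative_mul, hq, pderiv_mul, map_add, map_mul, map_mul,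
      aeval_X, pderiv_X]
    by_cases hk : k = c
    · subst hk
      simp
    · simp [hk]

/-- The specialised associated form `F(θ)` (`θ`: last group `↦ x̲`, other groups `↦` constants) is
homogeneous of degree `N` in `x̲` when `F` is homogeneous of degree `N` in its last group of
variables. [cite: NesterenkoPhilippon2001, Ch. 3, remark after Prop. 4.4 (p. 38)] -/
theorem isHomogeneous_aeval_lastBlock {s : ℕ} {F : RU (s + 1) m} {N : ℕ}
    (hF : ∀ γ ∈ F.support, ∑ j : Fin (m + 1), γ (Fin.last s, j) = N)
    (θ : Fin (s + 1) × Fin (m + 1) → MvPolynomial (Fin (m + 1)) ℂ)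
    (hθX : ∀ k, θ (Fin.last s, k) = X k) (hθC : ∀ w, w.1 ≠ Fin.last s → ∃ q : ℂ, θ w = C q) :
    (aeval θ F).IsHomogeneous N := by
  classical
  rw [F.as_sum, map_sum]
  refine IsHomogeneous.sum _ _ _ fun γ hγ => ?_
  rw [aeval_monomial, Finsupp.prod_pow, MvPolynomial.algebraMap_apply]
  have hprod : (∏ w, θ w ^ γ w).IsHomogeneous N := by
    have h := IsHomogeneous.prod Finset.univ (fun w => θ w ^ γ w)
      (fun w => if w.1 = Fin.last s then γ w else 0) fun w _ => ?_
    · have hsum : ∑ w : Fin (s + 1) × Fin (m + 1), (if w.1 = Fin.last s then γ w else 0) = N := by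
        rw [Fintype.sum_prod_type, Fin.sum_univ_castSucc]
        simp only [Fin.castSucc_ne_last, if_false, Finset.sum_const_zero, zero_add, if_true]
        exact hF γ hγ
      rwa [hsum] at h
    · by_cases hw : w.1 = Fin.last s
      · have hw' : w = (Fin.last s, w.2) := Prod.ext hw rfl
        rw [if_pos hw, hw', hθX]
        exact isHomogeneous_X_pow _ _
      · obtain ⟨q, hq⟩ := hθC w hw
        rw [if_neg hw, hq]
        simpa using (isHomogeneous_C _ q).pow (γ w)
  simpa using (isHomogeneous_C _ _).mul hprod

/-- For a form `P` of degree `N`, the restriction `f(t) = P(p + (t − p_c) e_c)` has degree `≤ N` and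
its coefficient of `t^N` is `P(e_c)`. [folklore] -/
theorem lineRestrict_natDegree_coeff {P : MvPolynomial (Fin (m + 1)) ℂ} {N : ℕ}
    (hP : P.IsHomogeneous N) (p : Fin (m + 1) → ℂ) (c : Fin (m + 1)) :
    (aeval (fun k => if k = c then Polynomial.X else Polynomial.C (p k)) P).natDegree ≤ N ∧
      (aeval (fun k => if k = c then Polynomial.X else Polynomial.C (p k)) P).coeff N =
        eval (Pi.single c 1) P := by
  classical
  have hsplit : ∀ e ∈ P.support, e c + ∑ k ∈ Finset.univ.erase c, e k = N := fun e he => by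
    rw [Finset.add_sum_erase _ _ (Finset.mem_univ c), ← Finsupp.degree_eq_sum, Finsupp.degree_apply]
    exact (hP.degree_eq_sum_deg_support he).symm
  -- the image of a monomial `a x^e`
  have hmono : ∀ (e : Fin (m + 1) →₀ ℕ) (a : ℂ),
      aeval (fun k => if k = c then Polynomial.X else Polynomial.C (p k)) (monomial e a) =
        Polynomial.C (a * ∏ k ∈ Finset.univ.erase c, p k ^ e k) * Polynomial.X ^ e c := by
    intro e a
    rw [aeval_monomial, Finsupp.prod_pow, Polynomial.algebraMap_eq,
      ← Finset.mul_prod_erase Finset.univ _ (Finset.mem_univ c), if_pos rfl, map_mul, map_prod]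
    have h2 : ∏ k ∈ Finset.univ.erase c,
        (if k = c then Polynomial.X else Polynomial.C (p k)) ^ e k =
        ∏ k ∈ Finset.univ.erase c, Polynomial.C (p k ^ e k) :=
      Finset.prod_congr rfl fun k hk => by rw [if_neg (Finset.ne_of_mem_erase hk), map_pow]
    rw [h2]
    ring
  rw [P.as_sum, map_sum, map_sum]
  refine ⟨Polynomial.natDegree_sum_le_of_forall_le _ _ fun e he => ?_, ?_⟩
  · rw [hmono]
    refine (Polynomial.natDegree_C_mul_X_pow_le _ _).trans ?_
    have := hsplit e he
    omega
  · rw [Polynomial.finsetSum_coeff]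
    refine Finset.sum_congr rfl fun e he => ?_
    rw [hmono, Polynomial.coeff_C_mul_X_pow, eval_monomial, Finsupp.prod_pow,
      ← Finset.mul_prod_erase Finset.univ _ (Finset.mem_univ c), Pi.single_eq_same, one_pow,
      one_mul]
    by_cases hc : e c = N
    · have hz : ∀ k ∈ Finset.univ.erase c, e k = 0 := fun k hk => by
        have := hsplit e he
        have hle := Finset.single_le_sum (fun k _ => Nat.zero_le (e k)) hk
        omega
      rw [if_pos hc.symm, Finset.prod_congr rfl fun k hk => by rw [hz k hk, pow_zero],
        Finset.prod_const_one, mul_one,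
        Finset.prod_congr rfl fun k hk => by rw [hz k hk, pow_zero], Finset.prod_const_one,
        mul_one]
    · rw [if_neg (Ne.symm hc)]
      obtain ⟨k, hk, hk0⟩ : ∃ k ∈ Finset.univ.erase c, e k ≠ 0 := by
        by_contra h
        push Not at h
        apply hc
        have := hsplit e he
        rw [Finset.sum_eq_zero h] at this
        omega
      rw [Finset.prod_eq_zero hk
        (by rw [Pi.single_eq_of_ne (Finset.ne_of_mem_erase hk), zero_pow hk0]), mul_zero]

/-! ## Simple roots from the Bézout identity; enumerating the roots -/

/-- If `α P + β ∂P/∂x_c = γ` with `γ` free of `x_c` and `γ(p) ≠ 0`, the restriction of `P` to the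
coordinate line through `p` in the direction `e_c` has only simple roots. [folklore] -/
theorem rootMultiplicity_le_one {P α β γ : MvPolynomial (Fin (m + 1)) ℂ} {c : Fin (m + 1)}
    (hB : α * P + β * pderiv c P = γ) (hγ : degreeOf c γ = 0) {p : Fin (m + 1) → ℂ}
    (hp : eval p γ ≠ 0)
    (hf0 : aeval (fun k => if k = c then Polynomial.X else Polynomial.C (p k)) P ≠ 0) (t : ℂ) :
    (aeval (fun k => if k = c then Polynomial.X else Polynomial.C (p k)) P).rootMultiplicity t
      ≤ 1 := by
  by_contra h
  rw [not_le, Polynomial.one_lt_rootMultiplicity_iff_isRoot hf0, Polynomial.IsRoot,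
    Polynomial.IsRoot, derivative_lineRestrict, eval_lineRestrict, eval_lineRestrict] at h
  apply hp
  have := congrArg (eval (Function.update p c t)) hB
  rw [map_add, map_mul, map_mul, h.1, h.2, mul_zero, mul_zero, add_zero,
    eval_update_eq_of_degreeOf hγ] at this
  exact this.symm

/-- A non-zero complex polynomial of degree `D` with only simple roots has `D` distinct roots.
[folklore] -/
theorem exists_distinct_roots {f : ℂ[X]} (hf0 : f ≠ 0) {D : ℕ} (hD : f.natDegree = D)
    (hmult : ∀ t, f.rootMultiplicity t ≤ 1) :
    ∃ t : Fin D → ℂ, Function.Injective t ∧ ∀ i, f.IsRoot (t i) := by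
  classical
  have hnodup : f.roots.Nodup :=
    Multiset.nodup_iff_count_le_one.mpr fun t => by rw [Polynomial.count_roots]; exact hmult t
  have hcard : f.roots.toFinset.card = D := by
    rw [Multiset.toFinset_card_of_nodup hnodup, IsAlgClosed.card_roots_eq_natDegree, hD]
  let e := (Finset.equivFinOfCardEq hcard).symm
  refine ⟨fun i => (e i : ℂ), fun i k hik => e.injective (Subtype.ext hik), fun i => ?_⟩
  exact (Polynomial.mem_roots hf0).mp (Multiset.mem_toFinset.mp (e i).2)

/-! ## The section form `F_v` and its zeros -/

/-- Evaluating a specialisation: `(F(θ))(u) = F(θ(u))`. [folklore] -/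
theorem eval_aeval {σ τ : Type*} (θ : τ → MvPolynomial σ ℂ) (u : σ → ℂ) (F : MvPolynomial τ ℚ) :
    eval u (aeval θ F) = aeval (fun w => eval u (θ w)) F := by
  rw [map_aeval, Subsingleton.elim ((eval u).comp (algebraMap ℚ (MvPolynomial σ ℂ)))
    (algebraMap ℚ ℂ)]
  rfl

/-- **Zeros of the section form.** For `θ` specialising the first group to the rational vector `v`
and the second to the variables, `F_v = F(θ)` (`F = chowForm 𝔭 2`) vanishes at `u ∈ ℂ^{m+1}` iff
some `β ∈ V(𝔭)` lies on both hyperplanes `v · x = 0` and `u · x = 0` (zeros theorem).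
[cite: NesterenkoPhilippon2001, Ch. 3 Prop. 4.4 (p. 38)] -/
theorem eval_sectionForm_eq_zero_iff {𝔭 : Ideal (Rx m)}
    (hhom : letI := MvPolynomial.gradedAlgebra (σ := Fin (m + 1)) (R := ℚ)
      𝔭.IsHomogeneous (homogeneousSubmodule (Fin (m + 1)) ℚ))
    (hpr : (elimIdeal 𝔭 (1 + 1)).IsPrincipal) (v : Fin (m + 1) → ℚ)
    (θ : Fin (1 + 1) × Fin (m + 1) → MvPolynomial (Fin (m + 1)) ℂ)
    (hθX : ∀ k, θ (Fin.last 1, k) = X k)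
    (hθC : ∀ w, w.1 ≠ Fin.last 1 → θ w = C ((v w.2 : ℚ) : ℂ)) (u : Fin (m + 1) → ℂ) :
    eval u (aeval θ (chowForm 𝔭 (1 + 1))) = 0 ↔
      ∃ β ∈ projZeros 𝔭, (∑ k, ((v k : ℚ) : ℂ) * β k = 0) ∧ ∑ k, u k * β k = 0 := by
  rw [eval_aeval, aeval_chowForm_eq_zero_iff hhom hpr]
  refine exists_congr fun β => and_congr_right fun _ => ?_
  have s0 : ∑ j, eval u (θ (0, j)) * β j = ∑ k, ((v k : ℚ) : ℂ) * β k :=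
    Finset.sum_congr rfl fun k _ => by rw [hθC (0, k) (show (0 : Fin (1 + 1)) ≠ _ by decide), eval_C]
  have s1 : ∑ j, eval u (θ (Fin.last 1, j)) * β j = ∑ k, u k * β k :=
    Finset.sum_congr rfl fun k _ => by rw [hθX, eval_X]
  refine ⟨fun h => ⟨s0.symm.trans (h 0), s1.symm.trans (h (Fin.last 1))⟩, fun h i => ?_⟩
  induction i using Fin.lastCases with
  | last => exact s1.trans h.2
  | cast j => obtain rfl : j = 0 := Subsingleton.elim _ _; exact s0.trans h.1

/-- **The points of a good section.** If the section form `F_v` satisfies a Bézout identity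
`α F_v + β ∂F_v/∂x_c = γ` with `γ ≠ 0` free of `x_c`, and `F_v(e_c) ≠ 0`, then the hyperplane
`v · x = 0` contains `D = deg 𝔭` pairwise non-proportional points of `V(𝔭)`. [folklore] -/
theorem exists_section_points {𝔭 : Ideal (Rx m)}
    (hhom : letI := MvPolynomial.gradedAlgebra (σ := Fin (m + 1)) (R := ℚ)
      𝔭.IsHomogeneous (homogeneousSubmodule (Fin (m + 1)) ℚ))
    (hpr : (elimIdeal 𝔭 (1 + 1)).IsPrincipal) (c : Fin (m + 1)) (v : Fin (m + 1) → ℚ)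
    (θ : Fin (1 + 1) × Fin (m + 1) → MvPolynomial (Fin (m + 1)) ℂ)
    (hθX : ∀ k, θ (Fin.last 1, k) = X k)
    (hθC : ∀ w, w.1 ≠ Fin.last 1 → θ w = C ((v w.2 : ℚ) : ℂ))
    (hB : ∃ α β γ : MvPolynomial (Fin (m + 1)) ℂ,
      α * aeval θ (chowForm 𝔭 (1 + 1)) + β * pderiv c (aeval θ (chowForm 𝔭 (1 + 1))) = γ ∧
        γ ≠ 0 ∧ degreeOf c γ = 0)
    (ha : eval (Pi.single c 1) (aeval θ (chowForm 𝔭 (1 + 1))) ≠ 0) :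
    ∃ β : Fin (ideg 𝔭 (1 + 1)) → (Fin (m + 1) → ℂ), (∀ i, β i ∈ projZeros 𝔭) ∧
      (∀ i, ∑ k, ((v k : ℚ) : ℂ) * β i k = 0) ∧
        ∀ i k, i ≠ k → ∃ p q, β i p * β k q ≠ β i q * β k p := by
  classical
  obtain ⟨α, β', γ, hBez, hγ0, hγc⟩ := hB
  -- a point `p` with `γ(p) ≠ 0`
  obtain ⟨p, hp⟩ : ∃ p : Fin (m + 1) → ℂ, eval p γ ≠ 0 := by
    by_contra! h; exact hγ0 (MvPolynomial.funext fun x => by rw [h x, map_zero])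
  -- the restriction `f` of `F_v` to the line `t ↦ p + (t - p_c) e_c`
  have hhomog : (aeval θ (chowForm 𝔭 (1 + 1))).IsHomogeneous (ideg 𝔭 (1 + 1)) :=
    isHomogeneous_aeval_lastBlock (fun γ hγ => sum_last_eq_ideg_of_mem_support_chowForm 𝔭 1 hγ) θ
      hθX (fun w hw => ⟨_, hθC w hw⟩)
  obtain ⟨hdeg_le, hcoeff⟩ := lineRestrict_natDegree_coeff hhomog p c
  rw [← hcoeff] at ha
  have hf0 : aeval (fun k => if k = c then Polynomial.X else Polynomial.C (p k))
      (aeval θ (chowForm 𝔭 (1 + 1))) ≠ 0 := fun h => ha (by rw [h, Polynomial.coeff_zero])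
  have hdegD := le_antisymm hdeg_le (Polynomial.le_natDegree_of_ne_zero ha)
  -- `D` distinct roots `tᵢ`
  obtain ⟨t, ht_inj, ht_root⟩ :=
    exists_distinct_roots hf0 hdegD (rootMultiplicity_le_one hBez hγc hp hf0)
  -- the points `βᵢ`
  have hzero : ∀ i, ∃ β ∈ projZeros 𝔭, (∑ k, ((v k : ℚ) : ℂ) * β k = 0) ∧
      ∑ k, Function.update p c (t i) k * β k = 0 := fun i => by
    rw [← eval_sectionForm_eq_zero_iff hhom hpr v θ hθX hθC, ← eval_lineRestrict]
    exact ht_root i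
  choose β hβZ hβv hβu using hzero
  refine ⟨β, hβZ, hβv, fun i k hik => ?_⟩
  by_contra hprop
  push Not at hprop
  -- `β_k ≠ 0`
  obtain ⟨q₀, hq₀⟩ := Function.ne_iff.mp (hβZ k).1
  -- `βᵢ` is proportional to `β_k`, hence orthogonal to `u_k`
  have h1 : ∑ l, Function.update p c (t k) l * β i l = 0 := by
    have h2 : (∑ l, Function.update p c (t k) l * β i l) * β k q₀ =
        β i q₀ * ∑ l, Function.update p c (t k) l * β k l := by
      rw [Finset.sum_mul, Finset.mul_sum]
      exact Finset.sum_congr rfl fun l _ => by rw [mul_assoc, hprop l q₀]; ring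
    rw [hβu k, mul_zero] at h2
    exact (mul_eq_zero.mp h2).resolve_right hq₀
  -- so `βᵢ ⊥ uᵢ - u_k = (tᵢ - t_k) e_c`, i.e. `βᵢ,c = 0`
  have h3 : (t i - t k) * β i c = 0 := by
    have h4 : ∑ l, (Function.update p c (t i) l - Function.update p c (t k) l) * β i l = 0 := by
      simp only [sub_mul, Finset.sum_sub_distrib, hβu i, h1, sub_zero]
    rw [Finset.sum_eq_single c (fun l _ hl => by
      rw [Function.update_of_ne hl, Function.update_of_ne hl, sub_self, zero_mul])
      (fun h => absurd (Finset.mem_univ c) h), Function.update_self, Function.update_self] at h4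
    exact h4
  have hβic : β i c = 0 :=
    (mul_eq_zero.mp h3).resolve_left (sub_ne_zero.mpr fun h => hik (ht_inj h))
  -- then `e_c` would be a zero of `F_v`
  apply ha
  rw [hcoeff, eval_sectionForm_eq_zero_iff hhom hpr v θ hθX hθC]
  refine ⟨β i, hβZ i, hβv i, ?_⟩
  rw [Finset.sum_eq_single c (fun l _ hl => by rw [Pi.single_eq_of_ne hl, zero_mul])
    (fun h => absurd (Finset.mem_univ c) h), Pi.single_eq_same, one_mul, hβic]

/-! ## Genericity in `v` -/

/-- **Main theorem (curried form).** [folklore] -/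
theorem exists_generic_section {𝔭 : Ideal (Rx m)} (h𝔭 : 𝔭.IsPrime)
    (hhom : letI := MvPolynomial.gradedAlgebra (σ := Fin (m + 1)) (R := ℚ)
      𝔭.IsHomogeneous (homogeneousSubmodule (Fin (m + 1)) ℚ))
    (hdim : ringKrullDim (Rx m ⧸ 𝔭) = (2 : ℕ)) :
    ∃ g : MvPolynomial (Fin (m + 1)) ℚ, g ≠ 0 ∧ ∀ v : Fin (m + 1) → ℚ, eval v g ≠ 0 →
      ∃ β : Fin (ideg 𝔭 2) → (Fin (m + 1) → ℂ), (∀ i, β i ∈ projZeros 𝔭) ∧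
        (∀ i, ∑ k, ((v k : ℚ) : ℂ) * β i k = 0) ∧
          ∀ i k, i ≠ k → ∃ p q, β i p * β k q ≠ β i q * β k p := by
  classical
  have hdim' : ringKrullDim (Rx m ⧸ 𝔭) = (1 + 1 : ℕ) := hdim
  obtain ⟨c, hc⟩ := exists_X_notMem_of_rank h𝔭 (by norm_num) hdim'
  have hpr : (elimIdeal 𝔭 (1 + 1)).IsPrincipal :=
    isPrincipal_elimIdeal_of_isPrime h𝔭 hhom (by norm_num) hdim'
  obtain ⟨g₂, hg₂0, hBg⟩ := CurveHilbert.exists_bezout_specialised ⟨𝔭, 1, c, h𝔭, hhom, hc, hdim'⟩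
  -- a rational point where `g₂ ≠ 0`; `g₁`: its last group frozen there
  obtain ⟨z, hz⟩ := exists_eval_ne_zero hg₂0
  have key : ∀ v : Fin (m + 1) → ℚ,
      eval v (aeval (fun w : Fin (1 + 1) × Fin (m + 1) =>
        if w.1 = Fin.last 1 then C (z w) else (X w.2 : MvPolynomial (Fin (m + 1)) ℚ)) g₂) =
        eval (fun w => if w.1 = Fin.last 1 then z w else v w.2) g₂ := fun v => by
    rw [map_aeval, Subsingleton.elim ((eval v).comp (algebraMap ℚ (MvPolynomial (Fin (m + 1)) ℚ)))
      (RingHom.id ℚ)]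
    refine congrArg (fun f => eval f g₂) (funext fun w => ?_)
    split_ifs <;> simp
  have hfin : ∀ i : Fin (1 + 1), i ≠ Fin.last 1 → i = 0 := by decide
  have hg₁0 : aeval (fun w : Fin (1 + 1) × Fin (m + 1) =>
      if w.1 = Fin.last 1 then C (z w) else (X w.2 : MvPolynomial (Fin (m + 1)) ℚ)) g₂ ≠ 0 := by
    intro h
    apply hz
    have h1 := key fun k => z (0, k)
    rw [h, map_zero] at h1
    rw [h1]
    refine congrArg (fun f => eval f g₂) (funext fun w => ?_)
    split_ifs with hw
    · rfl
    · rw [← hfin w.1 hw]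
  -- `a₁`: `v ↦ F(v; e_c)`
  have hinj : Function.Injective (Prod.snd : Fin 1 × Fin (m + 1) → Fin (m + 1)) :=
    fun a b h => Prod.ext (Subsingleton.elim _ _) h
  have ha₁0 : rename Prod.snd (aLead 1 c (chowForm 𝔭 (1 + 1))) ≠ 0 :=
    (map_ne_zero_iff _ (rename_injective _ hinj)).mpr (aLead_chowForm_ne_zero h𝔭 hhom hdim' hc)
  refine ⟨_ * _, mul_ne_zero hg₁0 ha₁0, fun v hv => ?_⟩
  rw [map_mul] at hv
  obtain ⟨hv₁, hv₂⟩ := mul_ne_zero_iff.mp hv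
  -- the specialisation `θ_v`
  let θ : Fin (1 + 1) × Fin (m + 1) → MvPolynomial (Fin (m + 1)) ℂ :=
    fun w => if w.1 = Fin.last 1 then X w.2 else C ((v w.2 : ℚ) : ℂ)
  have hθX : ∀ k, θ (Fin.last 1, k) = X k := fun k => if_pos rfl
  have hθC : ∀ w, w.1 ≠ Fin.last 1 → θ w = C ((v w.2 : ℚ) : ℂ) := fun w hw => if_neg hw
  refine exists_section_points hhom hpr c v θ hθX hθC ?_ ?_
  · refine hBg (fun w => if w.1 = Fin.last 1 then z w else v w.2) θ hθX (fun w hw => ?_) ?_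
    · rw [hθC w hw]
      simp only [if_neg hw]
    · rwa [← key]
  · rw [eval_aeval]
    have hfun : (fun w => eval (Pi.single c 1 : Fin (m + 1) → ℂ) (θ w)) =
        fun w : Fin (1 + 1) × Fin (m + 1) => Fin.lastCases (motive := fun _ => ℂ)
          (if w.2 = c then 1 else 0) (fun i => algebraMap ℚ ℂ ((v ∘ Prod.snd) (i, w.2))) w.1 := by
      funext w
      obtain ⟨i, k⟩ := w
      refine Fin.lastCases ?_ (fun i => ?_) i
      · rw [Fin.lastCases_last, hθX, eval_X, Pi.single_apply]
      · rw [Fin.lastCases_castSucc, hθC _ (Fin.castSucc_ne_last i), eval_C]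
        exact (eq_ratCast _ _).symm
    rw [hfun, aeval_lastCases_eq_algebraMap_eval_aLead,
      map_ne_zero_iff _ (algebraMap ℚ ℂ).injective, ← eval_rename]
    exact hv₂

end CurveHilbertGS

/-- **A generic rational hyperplane section of a prime curve has `deg 𝔭` distinct points
(registered helper `curveHilbert_genericSection`).** For a homogeneous prime `𝔭 ⊂ ℚ[x₀, …, x_m]`
with `dim ℚ[x̲]/𝔭 = 2` there is a non-zero rational polynomial `g` such that every rational
hyperplane `v · x = 0` with `g(v) ≠ 0` contains `ideg 𝔭 2` pairwise non-proportional points of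
`V(𝔭) ⊂ ℂ^{m+1}`. [folklore] -/
theorem curveHilbert_genericSection : ∀ (m : ℕ) (𝔭 : Ideal (Rx m)), 𝔭.IsPrime → (letI := MvPolynomial.gradedAlgebra (σ := Fin (m + 1)) (R := ℚ); 𝔭.IsHomogeneous (MvPolynomial.homogeneousSubmodule (Fin (m + 1)) ℚ)) → ringKrullDim (Rx m ⧸ 𝔭) = (2 : ℕ) → ∃ g : MvPolynomial (Fin (m + 1)) ℚ, g ≠ 0 ∧ ∀ v : Fin (m + 1) → ℚ, MvPolynomial.eval v g ≠ 0 → ∃ β : Fin (Literature.NumberTheory.Transcendental.Nesterenko.ideg 𝔭 2) → (Fin (m + 1) → ℂ), (∀ i, β i ∈ Literature.NumberTheory.Transcendental.Nesterenko.projZeros 𝔭) ∧ (∀ i, ∑ k, ((v k : ℚ) : ℂ) * β i k = 0) ∧ ∀ i k, i ≠ k → ∃ p q, β i p * β k q ≠ β i q * β k p := by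
  intro m 𝔭 h𝔭 hhom hdim
  exact CurveHilbertGS.exists_generic_section h𝔭 hhom hdim

end Summit.Schanuel.Schanuel.Cruxes.ApproximationProperty.OrbitInterpolationDeterminant

end
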